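import Summits.RiemannHypothesis.RiemannHypothesis.Theorems.Splittings.LiLowZeroBudgetFar
import HarnessLib

/-!
# RH-free LOW-ZERO BUDGET [γ] — the budget theorem, in the shape of the block law's budget clause (SketchG6B §§9–10)

Cell rh-split, seat rh-split-li-bridge g6 (brief sha16 f79c5f09d8bcb036), card `run/shared/lean/pub/rh-split/cards/SPLIT-li-bridge.md` §13
(13.5 paper proof «SOUND ON PAPER», referee rh-split-ref g3 06:17:36Z; 13.17); kernel source `HOME/rh-split-li-bridge/SketchG6T.lean` sha16
911a043700f05677 (2287 l; = SketchG6B [γ] ++ SketchG6C [α][β] ++ Part D [δ] ++ Part T, re-pointed at the tree's `LiIncrMeanSquare` /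
`LiIncrBlockLaw`, p508264 / p508611).  Filed by rh-split-typer-2 g4 (lane (xi)(c)–(f)) as a chain of ten tree modules cut at the scratch's
section boundaries, decl text byte-verbatim; deltas = namespaces `RhSplit.LiBridgeG6B/C/D/T` ↦
`…Theorems.Splittings.{LiLowZeroBudget, LiIncrHighPart, LiIncrBlockLawOfRH}` (qualified cross-references rewritten), module docstrings, and
one-line docstrings added where the scratch had none.  END-TO-END statement of the chain (last file):
`LiIncrBlockLawOfRH.rh_iff_almostAllLiMonotone : RiemannHypothesis ↔ ∃ E ⊆ ℕ of natural density zero, ∀ n ≥ 1, n ∉ E → λ_n ≤ λ_{n+1}`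
— T-Li3 IN KERNEL, a RELABELLING of RH (RH-EQUIVALENT, PROVED; certifies nothing about RH; class (li, bridge) unchanged).

This file: §9 the budget theorem; §10 the same in the shape of the budget clause of the TREE's `TLi3.LiIncrBlockLaw` (`blockLaw_budget_clause_log`).

HONEST LABEL: «SPLITTING SEARCH over kernel-typed RH-EQUIVALENCES; a splitting A ∧ B ⟹ RH is CONDITIONAL bookkeeping unless A and B are
both proved; nothing here bears on the truth of RH.»
-/

set_option linter.dupNamespace false

noncomputable section

namespace Summit.RiemannHypothesis.RiemannHypothesis.Theorems.Splittings.LiLowZeroBudget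

open Finset
open Literature.NumberTheory.LFunctions Literature.NumberTheory.LFunctions.SchoenfeldBound
open Summit.RiemannHypothesis.RiemannHypothesis.Theorems.LiTheory
open Summit.RiemannHypothesis.RiemannHypothesis.Theorems.Splittings.LiIncrMeanSquare.MeanSquare

/-! ## §9 The budget theorem -/

/-- Auxiliary lemma `budget_eq_near_add_far` of the low-zero budget [γ] assembly (li-bridge g6 `SketchG6T`; see the module docstring for its place in the argument). -/
theorem budget_eq_near_add_far (N : ℕ) (Y : ℝ) :
    budget N Y =
      ∑ ρ ∈ zerosBetween 0 Y, ∑ ρ' ∈ (zerosBetween 0 Y).filter (fun ρ' ↦ |ρ.im - ρ'.im| < 1),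
          term N ρ ρ' +
      ∑ ρ ∈ zerosBetween 0 Y, ∑ ρ' ∈ (zerosBetween 0 Y).filter (fun ρ' ↦ ¬ |ρ.im - ρ'.im| < 1),
          term N ρ ρ' := by
  unfold budget
  rw [← Finset.sum_add_distrib]
  apply Finset.sum_congr rfl
  intro ρ _
  rw [Finset.sum_filter_add_sum_filter_not]

/-- Growth of the logarithmic factor: `M L² (1+L) ≤ 125 (Y+3)²` (`M = ⌈Y⌉`, `L = log(M+2)`). -/
theorem log_factor_le {Y : ℝ} (hY : 0 ≤ Y) :
    (⌈Y⌉₊ : ℝ) * Real.log ((⌈Y⌉₊ : ℝ) + 2) ^ 2 * (1 + Real.log ((⌈Y⌉₊ : ℝ) + 2)) ≤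
      125 * (Y + 3) ^ 2 := by
  set M := ⌈Y⌉₊ with hM
  set L := Real.log ((M : ℝ) + 2) with hL
  have hM0 : (0 : ℝ) ≤ M := Nat.cast_nonneg M
  have hL0 : 0 ≤ L := Real.log_nonneg (by linarith)
  have hM1 : (M : ℝ) < Y + 1 := Nat.ceil_lt_add_one hY
  have hcube := one_add_log_cube_le hM0
  rw [← hL] at hcube
  have h1 : L ^ 2 * (1 + L) ≤ (1 + L) ^ 3 := by nlinarith
  calc (M : ℝ) * L ^ 2 * (1 + L) = M * (L ^ 2 * (1 + L)) := by ring
    _ ≤ M * (125 * ((M : ℝ) + 2)) :=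
        mul_le_mul_of_nonneg_left (h1.trans hcube) hM0
    _ ≤ 125 * (Y + 3) ^ 2 := by nlinarith

/-- **The RH-free low-zero budget, explicit form.**
`budget N Y ≤ 26.4·P·N + 90000 π (Y+3)²` for `N ≥ 1`, `Y ≥ 0`. -/
theorem budget_le_explicit {N : ℕ} (hN : 1 ≤ N) {Y : ℝ} (hY : 0 ≤ Y) :
    budget N Y ≤ 26.4 * nearConst * N + 90000 * Real.pi * (Y + 3) ^ 2 := by
  have hN0 : 0 < N := hN
  rw [budget_eq_near_add_far]
  have h1 := near_total_le hN0 Y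
  have h2 := far_total_le N Y
  have h3 := log_factor_le hY
  have hπ := Real.pi_pos
  nlinarith

/-- **Stub [γ] of the T-Li3 skeleton (card §13.5, clause 4), RH-free:**
there are absolute constants `C₁, C₂ ≥ 0` with `budget N Y ≤ C₁ N + C₂ (Y+3)²`; with the paper
proof's truncation `Y = √(λN)` this is `O_λ(N) = o(N log N)`. -/
theorem budget_le : ∃ C₁ C₂ : ℝ, 0 ≤ C₁ ∧ 0 ≤ C₂ ∧
    ∀ (N : ℕ) (Y : ℝ), 1 ≤ N → 0 ≤ Y → budget N Y ≤ C₁ * N + C₂ * (Y + 3) ^ 2 :=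
  ⟨26.4 * nearConst, 90000 * Real.pi, by have := nearConst_nonneg; positivity,
    by have := Real.pi_pos; positivity, fun _ _ hN hY ↦ budget_le_explicit hN hY⟩

/-- Corollary at the paper-proof scale `Y² ≤ λ N` (`λ ≥ 1`): `budget ≤ C(λ) · N`. -/
theorem budget_le_linear {lam : ℝ} (hlam : 1 ≤ lam) :
    ∃ C : ℝ, 0 ≤ C ∧ ∀ (N : ℕ) (Y : ℝ), 1 ≤ N → 0 ≤ Y → Y ^ 2 ≤ lam * N →
      budget N Y ≤ C * N := by
  obtain ⟨C₁, C₂, hC₁, hC₂, h⟩ := budget_le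
  refine ⟨C₁ + C₂ * (20 * lam), by positivity, fun N Y hN hY hYN ↦ ?_⟩
  have hN1 : (1 : ℝ) ≤ N := by exact_mod_cast hN
  have hb := h N Y hN hY
  have hlamN : 1 ≤ lam * N := by nlinarith
  -- `(Y+3)² ≤ 2Y² + 18 ≤ 2 λ N + 18 λ N`
  have h1 : (Y + 3) ^ 2 ≤ 2 * Y ^ 2 + 18 := by nlinarith [sq_nonneg (Y - 3)]
  have h2 : (Y + 3) ^ 2 ≤ 20 * lam * N := by linarith
  calc budget N Y ≤ C₁ * N + C₂ * (Y + 3) ^ 2 := hb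
    _ ≤ C₁ * N + C₂ * (20 * lam * N) := by
        have := mul_le_mul_of_nonneg_left h2 hC₂; linarith
    _ = (C₁ + C₂ * (20 * lam)) * N := by ring

/-! ## §10 In the shape of the block law's budget clause (`TLi3.LiIncrBlockLaw`, SketchG6 §5)

Index the low zeros by themselves (`ι = ℂ`, `s = zerosBetween 0 Y`; the mean-square ENGINE
`MeanSquare.sum_sq_le'` of SketchG6 is generic in the index type), amplitudes `a_ρ = m_ρ·4 sin(θ_ρ/2)
≥ 0`, phases `θ_ρ ∈ (0, π/2]`: the clause `Σ_{j,k} |a_j||a_k| D_N(θ_j − θ_k) ≤ K·N·log N` then holds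
with ROOM (`≤ C(λ)·N`) at `Y² ≤ λN`.  (The phantom boundary index `⋆` of card §13.5 and the passage
`ℂ`-indexed ↦ `ℕ`-indexed are bookkeeping for the composition step [δ].) -/

/-- Phases of zeros of height `> 14` lie in `(0, π/2]`. -/
theorem phase_mem {ρ : ℂ} (hγ : 14 < ρ.im) : 0 < phase ρ ∧ phase ρ ≤ Real.pi / 2 := by
  have hγ0 : 0 < ρ.im := by linarith
  unfold phase
  constructor
  · unfold liZeroAngle
    have : 0 < Real.arctan (1 / (2 * ρ.im)) := Real.arctan_pos.2 (by positivity)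
    linarith
  · have h := (SmoothReplace.liZeroAngle_bounds hγ0).2
    have : 1 / ρ.im ≤ 1 / 14 := one_div_le_one_div_of_le (by norm_num) hγ.le
    linarith [Real.pi_gt_three]

/-- The amplitude with multiplicity: `a_ρ := m_ρ · 4 sin(θ_ρ/2)`. -/
def ampM (ρ : ℂ) : ℝ := mult ρ * amp ρ

/-- Auxiliary lemma `ampM_nonneg` of the low-zero budget [γ] assembly (li-bridge g6 `SketchG6T`; see the module docstring for its place in the argument). -/
theorem ampM_nonneg {Y : ℝ} {ρ : ℂ} (hρ : ρ ∈ zerosBetween 0 Y) : 0 ≤ ampM ρ :=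
  mul_nonneg (mult_nonneg le_rfl hρ) (amp_bounds (fourteen_lt_im hρ)).1

/-- Auxiliary lemma `ampM_le` of the low-zero budget [γ] assembly (li-bridge g6 `SketchG6T`; see the module docstring for its place in the argument). -/
theorem ampM_le {Y : ℝ} {ρ : ℂ} (hρ : ρ ∈ zerosBetween 0 Y) : ampM ρ ≤ mult ρ * (2 / ρ.im) :=
  mul_le_mul_of_nonneg_left (amp_bounds (fourteen_lt_im hρ)).2 (mult_nonneg le_rfl hρ)

/-- Auxiliary lemma `abs_ampM_mul_eq_term` of the low-zero budget [γ] assembly (li-bridge g6 `SketchG6T`; see the module docstring for its place in the argument). -/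
theorem abs_ampM_mul_eq_term {Y : ℝ} {ρ ρ' : ℂ} (hρ : ρ ∈ zerosBetween 0 Y)
    (hρ' : ρ' ∈ zerosBetween 0 Y) (N : ℕ) :
    |ampM ρ| * |ampM ρ'| * dirichletBound N (phase ρ - phase ρ') = term N ρ ρ' := by
  rw [abs_of_nonneg (ampM_nonneg hρ), abs_of_nonneg (ampM_nonneg hρ')]
  unfold ampM term
  ring

/-- **Budget clause of the block law for the low-zero family (RH-free).**  For `λ ≥ 1` there is
`C = C(λ) ≥ 0` with: for all `N ≥ 1`, `0 ≤ Y`, `Y² ≤ λN`, the phases of the zeros `0 < γ ≤ Y` lie in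
`(0, π/2]` and `Σ_{ρ,ρ'} |a_ρ||a_ρ'| D_N(θ_ρ − θ_ρ') ≤ C·N` (`≤ K·N·log N` for `N ≥ 3` with `K = C`). -/
theorem blockLaw_budget_clause {lam : ℝ} (hlam : 1 ≤ lam) :
    ∃ C : ℝ, 0 ≤ C ∧ ∀ (N : ℕ) (Y : ℝ), 1 ≤ N → 0 ≤ Y → Y ^ 2 ≤ lam * N →
      (∀ ρ ∈ zerosBetween 0 Y, 0 < phase ρ ∧ phase ρ ≤ Real.pi / 2) ∧
      ∑ ρ ∈ zerosBetween 0 Y, ∑ ρ' ∈ zerosBetween 0 Y,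
        |ampM ρ| * |ampM ρ'| * dirichletBound N (phase ρ - phase ρ') ≤ C * N := by
  obtain ⟨C, hC, h⟩ := budget_le_linear hlam
  refine ⟨C, hC, fun N Y hN hY hYN ↦ ⟨fun ρ hρ ↦ phase_mem (fourteen_lt_im hρ), ?_⟩⟩
  calc _ = budget N Y := by
        unfold budget
        apply Finset.sum_congr rfl
        intro ρ hρ
        apply Finset.sum_congr rfl
        intro ρ' hρ'
        exact abs_ampM_mul_eq_term hρ hρ' N
    _ ≤ C * N := h N Y hN hY hYN

/-- The same with the block law's literal right-hand side `K · N · log N` (`N ≥ 3`). -/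
theorem blockLaw_budget_clause_log {lam : ℝ} (hlam : 1 ≤ lam) :
    ∃ K : ℝ, 0 ≤ K ∧ ∀ (N : ℕ) (Y : ℝ), 3 ≤ N → 0 ≤ Y → Y ^ 2 ≤ lam * N →
      ∑ ρ ∈ zerosBetween 0 Y, ∑ ρ' ∈ zerosBetween 0 Y,
        |ampM ρ| * |ampM ρ'| * dirichletBound N (phase ρ - phase ρ') ≤ K * N * Real.log N := by
  obtain ⟨C, hC, h⟩ := blockLaw_budget_clause hlam
  refine ⟨C, hC, fun N Y hN hY hYN ↦ ?_⟩
  have hN3 : (3 : ℝ) ≤ N := by exact_mod_cast hN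
  have hlog : 1 ≤ Real.log N := by
    rw [← Real.log_exp 1]
    apply Real.log_le_log (Real.exp_pos 1)
    have := Real.exp_one_lt_d9
    linarith
  have hb := (h N Y (by omega) hY hYN).2
  have hCN : 0 ≤ C * N := by positivity
  calc _ ≤ C * N := hb
    _ = C * N * 1 := by ring
    _ ≤ C * N * Real.log N := mul_le_mul_of_nonneg_left hlog hCN

end Summit.RiemannHypothesis.RiemannHypothesis.Theorems.Splittings.LiLowZeroBudget

end
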